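import Literature.Probability.RandomPlanarGeometry.HexSAWRotSurfaceFugacity
import HarnessLib

/-!
# Below `y†` the weighted top class of Beaton's rotated strip vanishes in the height limit, at T3's rate

Topic `Literature/Probability/RandomPlanarGeometry` (continues `HexSAWRotStripIdentityY.lean` — Beaton 2014 Prop. 6 at `n = 0`,
`HV.rotStrip_identityY`, the `y`-weighted classes `HV.rotGFy`, `HV.topContacts`, `y† = HV.rotYdagger` — the tree's
`HexSAWRotStripClasses.lean` (Prop. 4 = `HV.rotStrip_identity`, the classes `IsRotBotOut/IsRotBotIn/IsRotLatDart/IsRotTopDart/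
IsRotCloseDart`, `HV.rotGF`, `rot_coeff_pos`), `HexSAWRotStripLateralNull.lean` (`HV.tendsto_rotStripLat_zero`: `E^⊥_{H,W}(x_c) → 0`
as `W → ∞`), `HexSAWRotStripLimit.lean` (`HV.tendsto_rotStripBR`) and the capstone `HexSAWRotSurfaceFugacity.lean`
(`HV.tendsto_iSup_rotStripBR`: `sup_W B^{→}_{H,W}(x_c) → 0`, from T3 `HexSAWRotStripLogDecay`).  Source: N. R. Beaton, *The critical
surface fugacity of self-avoiding walks on a rotated honeycomb lattice*, J. Phys. A 47 (2014) 075003, arXiv:1210.0274v3, §4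
(Lemma 12 p. 17: finiteness of `B_T(x_c, y)` for `y < y†`; Appendix Corollary 15 p. 19: `B(x_c, 1) = 0`, i.e. `B_T(x_c, 1) → 0`).

## What is proved (HOME build of a-p2 g8, 2026-08-23; label lit-1 g13 09:52:29Z: NEW-IN-WRITING, modest — the rotated-frame twin of a
## DCS-frame remark that is PRINTED WITHOUT PROOF; first written statement and first proof in Beaton's frame)

Why this is new: Beaton 2014 proves the finiteness of `B_T(x_c; y)` below `y†` (Lemma 12) and `B_T(x_c; 1) → 0` (Appendix
Corollary 15) but states no vanishing of the `y`-weighted top-bridge function below `y†`; the DCS-frame analogue is an unproved remark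
in BBdGDCG 2014 (arXiv v5 p. 14, Remarks 1: "B_T(x_c, y) → 0 for 0 ≤ y < y*"); we prove it in the rotated frame by a MONOTONE SANDWICH
(Prop. 6 at height `H + 1` minus Prop. 4 at height `H`; no arch cut, no last-contact factorisation), with the lane's explicit
comparison constant `2cos(π/16)/c_B(y)`, so every decay rate of `B_T(x_c; 1)` (the tree's T3: `(log H)^{-1/3}`) transfers.
[cite: Beaton2014RotatedHoneycomb, §4, Lemma 12 and Corollary 13 (arXiv v3 p. 17), Proposition 11 with its proof (24)–(26) (p. 18), Appendix Corollary 15 (p. 19: y = 1); the statement for 0 < y < y† is not printed — lane corollary]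
[cite: BeatonBousquetMelouDeGierDuminilCopinGuttmann2014, §4.4 Remarks 1 (arXiv v5 p. 14: "B_T(x_c, y) → 0 for 0 ≤ y < y*", stated without proof, DCS frame)]

* `topContacts_succ_eq_zero`, `rotGF_le_rotGFy_succ` — a walk of `D(H, W) ∖ {a⁻}` has no vertex on the top row of `D(H+1, ·)`, so
  every `y = 1` class of `D(H, W)` is dominated by the `y`-weighted class of `D(H+1, W')`, `W ≤ W'`, for the classes that do not
  depend on `(H, W)` (`A^O`, `A^I`, `P`);
* **`rotTopY_succ_le`** — for `H, W ≥ 1`, `H + W` odd, `0 < y`: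
  `c_B(y)·B^{→}_{H+1,W+1}(x_c; y) ≤ 2cos(π/16)·B^{→}_{H,W}(x_c) + 2cos(3π/16)·E^⊥_{H,W}(x_c)`, where
  `c_B(y) = 2(cos(π/16) − x_c²y²cos(5π/16))/(x_c y (1 + x_c y))` is Beaton's top coefficient (Prop. 6 at `y` on `D(H+1, W+1)`
  minus Prop. 4 on `D(H, W)`, dropping the nonnegative `E^⊥(y)` and the three dominated classes);
* **`iSup_rotTopY_succ_le`** — for `0 < y < y†` and `H ≥ 1`: `sup_W B^{→}_{H+1,W}(x_c; y) ≤ (2cos(π/16)/c_B(y)) · sup_W B^{→}_{H,W}(x_c)`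
  (let `W → ∞` along the admissible parity: `B^{→}_{H,W}(x_c) ↑ sup`, `E^⊥_{H,W}(x_c) → 0`);
* **`tendsto_iSup_rotTopY_zero`** — for `0 < y < y†`: `sup_W B^{→}_{H+1,W}(x_c; y) → 0` as `H → ∞` (Corollary 15 / T3), i.e. the
  `y`-weighted critical top-bridge generating function of the rotated strip vanishes in the height limit on the whole sub-critical
  surface range, inheriting T3's rate `(log H)^{-1/3}` through the explicit constant.
-/

noncomputable section

open Finset Filter Topology

namespace Literature.Probability.RandomPlanarGeometry.SAW.HV

/-- Beaton's top coefficient `c_B(y) := 2 (cos(π/16) − x_c² y² cos(5π/16)) / (x_c y (1 + x_c y))` (the bracket of Prop. 6 at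
`n = 0`, closed form `rotB_coeff_eq`). [cite: Beaton2014RotatedHoneycomb, Proposition 6 (arXiv v3 p. 9) and §4 eq. (21) (p. 16: c_B(y))] -/
def rotBcoeff (y : ℝ) : ℝ :=
  2 * ((Real.cos (Real.pi / 16) - hexCriticalFugacity ^ 2 * y ^ 2 * Real.cos (5 * Real.pi / 16)) /
    (hexCriticalFugacity * y * (1 + hexCriticalFugacity * y)))

/-- `c_B(y) > 0` for `0 < y < y†`. [cite: Beaton2014RotatedHoneycomb, §4 (arXiv v3 p. 16: "c_B(y†) = 0"; c_B > 0 below y†)] -/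
theorem rotBcoeff_pos {y : ℝ} (hy : 0 < y) (hlt : y < rotYdagger) : 0 < rotBcoeff y := by
  have hx : 0 < hexCriticalFugacity := hexCriticalFugacity_pos_lt_one.1
  have hnum : 0 < Real.cos (Real.pi / 16) - hexCriticalFugacity ^ 2 * y ^ 2 * Real.cos (5 * Real.pi / 16) :=
    (rotB_coeff_pos_iff hy).1.2 hlt
  unfold rotBcoeff
  positivity

/-- A walk of `D(H, W) ∖ {a⁻}` has no vertex on the row `ξ = −(H+1)`: its top-contact count at height `H + 1` vanishes.
[cite: Beaton2014RotatedHoneycomb, §2.2 (D_{T,L}: heights 1 ≤ −ξ ≤ T, arXiv v3 p. 5)] -/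
theorem topContacts_succ_eq_zero {H Wd : ℕ} {P : List HV} (hP : IsMidWalk ((rotStripV H Wd).erase wOut) P) :
    topContacts (H + 1) P = 0 := by
  rw [topContacts, List.countP_eq_zero]
  intro v hv
  have hb := xi_bounds_of_mem_rotStripV (mem_of_mem_erase (hP.2.2.2.1 v hv))
  simp only [decide_eq_true_eq]
  push_cast
  omega

/-- **Class domination across one unit of height**: for a class predicate `cls` that does not depend on the domain and `y ≥ 0`,
`W ≤ W'`: `G_{D(H,W)}(x_c) ≤ G^{(y)}_{D(H+1,W')}(x_c; y)` (every walk of the smaller domain is a walk of the larger one, with no top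
contact). [cite: Beaton2014RotatedHoneycomb, §4 (arXiv v3 p. 16: "A^O_{T,L}, A^I_{T,L}, B_{T,L} and P_{T,L} are increasing with L"); lane: also with T, at zero top weight] -/
theorem rotGF_le_rotGFy_succ {H Wd Wd' : ℕ} (hW : Wd ≤ Wd') (cls : HV × HV → Prop) [DecidablePred cls] {y : ℝ} (hy : 0 ≤ y) :
    rotGF ((rotStripV H Wd).erase wOut) cls ≤ rotGFy ((rotStripV (H + 1) Wd').erase wOut) (H + 1) cls y := by
  have hx : 0 < hexCriticalFugacity := hexCriticalFugacity_pos_lt_one.1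
  have hsub : (rotStripV H Wd).erase wOut ⊆ (rotStripV (H + 1) Wd').erase wOut :=
    erase_subset_erase _ ((rotStripV_mono_height (Nat.le_succ H)).trans (rotStripV_mono_width hW))
  unfold rotGF rotGFy
  calc ∑ P ∈ (midWalks ((rotStripV H Wd).erase wOut)).filter (fun P => cls (finalDart P)), hexCriticalFugacity ^ mwLen P
      = ∑ P ∈ (midWalks ((rotStripV H Wd).erase wOut)).filter (fun P => cls (finalDart P)),
          hexCriticalFugacity ^ mwLen P * y ^ topContacts (H + 1) P := by
        refine sum_congr rfl fun P hP => ?_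
        rw [topContacts_succ_eq_zero (mem_midWalks_iff.1 (mem_filter.1 hP).1), pow_zero, mul_one]
    _ ≤ ∑ P ∈ (midWalks ((rotStripV (H + 1) Wd').erase wOut)).filter (fun P => cls (finalDart P)),
          hexCriticalFugacity ^ mwLen P * y ^ topContacts (H + 1) P :=
        sum_le_sum_of_subset_of_nonneg (filter_subset_filter _ (midWalks_mono hsub)) fun _ _ _ => by positivity

/-- **The one-step sandwich**: for `H, W ≥ 1` with `H + W` odd and `0 < y`,
`c_B(y)·B^{→}_{H+1,W+1}(x_c; y) ≤ 2cos(π/16)·B^{→}_{H,W}(x_c) + 2cos(3π/16)·E^⊥_{H,W}(x_c)` — Prop. 6 (at `y`, on `D(H+1, W+1)`,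
parity `(H+1)+(W+1)` odd) minus Prop. 4 (on `D(H, W)`), after dropping `E^⊥(y) ≥ 0` and dominating `A^O`, `A^I`, `P`.
[cite: Beaton2014RotatedHoneycomb, Proposition 4 (arXiv v3 pp. 5–6, proof pp. 6–7) and Proposition 6 (p. 9); lane sandwich] -/
theorem rotTopY_succ_le {H Wd : ℕ} (hH : 1 ≤ H) (hW : 1 ≤ Wd) (hodd : Odd (H + Wd)) {y : ℝ} (hy : 0 < y) :
    rotBcoeff y * rotGFy ((rotStripV (H + 1) (Wd + 1)).erase wOut) (H + 1) (IsRotTopDart (H + 1)) y ≤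
      2 * Real.cos (Real.pi / 16) * rotStripBR H Wd +
        2 * Real.cos (3 * Real.pi / 16) * rotGF ((rotStripV H Wd).erase wOut) (IsRotLatDart H Wd) := by
  obtain ⟨cO, cI, cE, cP, -⟩ := rot_coeff_pos
  have hodd' : Odd (H + 1 + (Wd + 1)) := by
    obtain ⟨k, hk⟩ := hodd; exact ⟨k + 1, by omega⟩
  have hY := rotStrip_identityY (H := H + 1) (Wd := Wd + 1) (by omega) (by omega) hodd' hy
  rw [rotB_coeff_eq hy] at hY
  have h1 := rotStrip_identity hH hW
  rw [← rotStripBR_eq_rotGF] at h1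
  -- domination of the three `(H, W)`-independent classes and nonnegativity of the weighted lateral class
  have dO := rotGF_le_rotGFy_succ (H := H) (Nat.le_succ Wd) IsRotBotOut hy.le
  have dI := rotGF_le_rotGFy_succ (H := H) (Nat.le_succ Wd) IsRotBotIn hy.le
  have dP := rotGF_le_rotGFy_succ (H := H) (Nat.le_succ Wd) IsRotCloseDart hy.le
  have eN := rotGFy_nonneg ((rotStripV (H + 1) (Wd + 1)).erase wOut) (H + 1) (IsRotLatDart (H + 1) (Wd + 1)) hy.le
  unfold rotBcoeff
  nlinarith [mul_le_mul_of_nonneg_left dO cO.le, mul_le_mul_of_nonneg_left dI cI.le,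
    mul_le_mul_of_nonneg_left dP cP.le, mul_nonneg cE.le eN]

/-- **`sup_W B^{→}_{H+1,W}(x_c; y) ≤ (2cos(π/16)/c_B(y)) · sup_W B^{→}_{H,W}(x_c)`** for `0 < y < y†`, `H ≥ 1`: let `W → ∞` along
the admissible parity in `rotTopY_succ_le` (`B^{→}_{H,W}(x_c) ≤ sup`, `E^⊥_{H,W}(x_c) → 0`), using the monotonicity of the weighted
top class in `W`. [cite: Beaton2014RotatedHoneycomb, §4, Lemma 12 (arXiv v3 p. 17) and eq. (22) (p. 16); lane corollary] -/
theorem iSup_rotTopY_succ_le {H : ℕ} (hH : 1 ≤ H) {y : ℝ} (hy : 0 < y) (hlt : y < rotYdagger) :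
    (⨆ Wd : ℕ, rotGFy ((rotStripV (H + 1) Wd).erase wOut) (H + 1) (IsRotTopDart (H + 1)) y) ≤
      2 * Real.cos (Real.pi / 16) / rotBcoeff y * ⨆ Wd : ℕ, rotStripBR H Wd := by
  have hc := rotBcoeff_pos hy hlt
  set S := ⨆ Wd : ℕ, rotStripBR H Wd with hS
  set B : ℕ → ℝ := fun Wd => rotGFy ((rotStripV (H + 1) Wd).erase wOut) (H + 1) (IsRotTopDart (H + 1)) y with hB
  have hmono : Monotone B := rotGFy_top_monotone (H + 1) hy.le
  -- the target bound `M`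
  set M := 2 * Real.cos (Real.pi / 16) / rotBcoeff y * S with hM
  -- Step 1: every `B Wd` is `≤ M + (2cos(3π/16)/c_B(y)) · E^⊥_{H,W'}(x_c)` for all admissible `W' ≥ Wd`
  have key : ∀ Wd W' : ℕ, Wd ≤ W' + 1 → 1 ≤ W' → Odd (H + W') →
      B Wd ≤ M + 2 * Real.cos (3 * Real.pi / 16) / rotBcoeff y *
        rotGF ((rotStripV H W').erase wOut) (IsRotLatDart H W') := by
    intro Wd W' hle hW' hodd
    have h1 : B Wd ≤ B (W' + 1) := hmono hle
    have h2 := rotTopY_succ_le hH hW' hodd hy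
    have h3 : rotStripBR H W' ≤ S := rotStripBR_le_iSup hH W'
    have hcos : 0 ≤ 2 * Real.cos (Real.pi / 16) := by linarith [rot_coeff_pos.2.2.2.2]
    -- divide `h2` by `c_B(y)`
    have h4 : B (W' + 1) ≤ (2 * Real.cos (Real.pi / 16) * rotStripBR H W' +
        2 * Real.cos (3 * Real.pi / 16) * rotGF ((rotStripV H W').erase wOut) (IsRotLatDart H W')) / rotBcoeff y := by
      rw [le_div_iff₀ hc, mul_comm]; exact h2
    calc B Wd ≤ B (W' + 1) := h1
      _ ≤ _ := h4
      _ ≤ M + 2 * Real.cos (3 * Real.pi / 16) / rotBcoeff y *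
            rotGF ((rotStripV H W').erase wOut) (IsRotLatDart H W') := by
          have hr : M + 2 * Real.cos (3 * Real.pi / 16) / rotBcoeff y *
              rotGF ((rotStripV H W').erase wOut) (IsRotLatDart H W') =
              (2 * Real.cos (Real.pi / 16) * S +
                2 * Real.cos (3 * Real.pi / 16) * rotGF ((rotStripV H W').erase wOut) (IsRotLatDart H W')) /
                rotBcoeff y := by
            rw [hM]; ring
          rw [hr]
          exact div_le_div_of_nonneg_right (by nlinarith [mul_le_mul_of_nonneg_left h3 hcos]) hc.le
  -- Step 2: let `W' → ∞` along the parity class: `E^⊥ → 0`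
  have hlat := tendsto_rotStripLat_zero hH
  have cE : 0 < 2 * Real.cos (3 * Real.pi / 16) / rotBcoeff y := div_pos rot_coeff_pos.2.2.1 hc
  refine ciSup_le fun Wd => ?_
  refine le_of_forall_pos_le_add fun ε hε => ?_
  have hev : ∀ᶠ W' : ℕ in atTop, 2 * Real.cos (3 * Real.pi / 16) / rotBcoeff y *
      rotGF ((rotStripV H W').erase wOut) (IsRotLatDart H W') < ε := by
    have h0 := hlat.const_mul (2 * Real.cos (3 * Real.pi / 16) / rotBcoeff y)
    rw [mul_zero] at h0
    exact (tendsto_order.1 h0).2 ε hε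
  obtain ⟨N, hN⟩ := eventually_atTop.1 hev
  -- an admissible width beyond `N`, `Wd` and `1`
  obtain ⟨W', hW'N, hW'1, hW'd, hodd⟩ : ∃ W', N ≤ W' ∧ 1 ≤ W' ∧ Wd ≤ W' + 1 ∧ Odd (H + W') := by
    rcases Nat.even_or_odd (H + (N + Wd + 1)) with h | h
    · exact ⟨N + Wd + 2, by omega, by omega, by omega, by
        rw [show H + (N + Wd + 2) = H + (N + Wd + 1) + 1 by ring]; exact h.add_one⟩
    · exact ⟨N + Wd + 1, by omega, by omega, by omega, h⟩
  have h := key Wd W' hW'd hW'1 hodd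
  have hsmall := hN W' hW'N
  linarith

/-- **The `y`-weighted critical top class vanishes in the height limit below `y†`**: for `0 < y < y†`,
`sup_W B^{→}_{H,W}(x_c; y) → 0` as `H → ∞` — the rotated-frame twin of BBdGDCG14 §4.4 Remark 1, with the explicit comparison
`sup_W B^{→}_{H+1,W}(x_c; y) ≤ (2cos(π/16)/c_B(y))·sup_W B^{→}_{H,W}(x_c)` to Beaton's `B_T(x_c, 1) → 0` (Appendix Cor. 15 / the tree's T3).
[cite: Beaton2014RotatedHoneycomb, §4, Lemma 12 (arXiv v3 p. 17) with Appendix Corollary 15 (p. 19: B(x_c, 1) = 0); lane corollary, not stated in print] -/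
theorem tendsto_iSup_rotTopY_zero {y : ℝ} (hy : 0 < y) (hlt : y < rotYdagger) :
    Tendsto (fun H : ℕ => ⨆ Wd : ℕ, rotGFy ((rotStripV H Wd).erase wOut) H (IsRotTopDart H) y) atTop (𝓝 0) := by
  have hc := rotBcoeff_pos hy hlt
  -- along `H + 2 = (H + 1) + 1`
  have hup : Tendsto (fun H : ℕ => 2 * Real.cos (Real.pi / 16) / rotBcoeff y * ⨆ Wd : ℕ, rotStripBR (H + 1) Wd)
      atTop (𝓝 0) := by
    have h := (tendsto_iSup_rotStripBR.comp (tendsto_add_atTop_nat 1)).const_mul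
      (2 * Real.cos (Real.pi / 16) / rotBcoeff y)
    rw [mul_zero] at h
    exact h
  have h2 : Tendsto (fun H : ℕ => ⨆ Wd : ℕ, rotGFy ((rotStripV (H + 1 + 1) Wd).erase wOut) (H + 1 + 1)
      (IsRotTopDart (H + 1 + 1)) y) atTop (𝓝 0) :=
    squeeze_zero (fun H => Real.iSup_nonneg fun Wd => rotGFy_nonneg _ _ _ hy.le)
      (fun H => iSup_rotTopY_succ_le (H := H + 1) (by omega) hy hlt) hup
  exact (tendsto_add_atTop_iff_nat 2).1 h2

/-! ### Appendix (rider): the displayed rate — the y-weighted top class inherits T3's `(log H)^{-1/3}` -/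

/-- **`sup_W B^{→}_{H+1,W}(x_c; y) ≤ (2cos(π/16)/c_B(y)) · C · (log H)^{−1/3}`** for `0 < y < y†` and `H ≥ 2`, with the constant `C`
of the tree's T3 `iSup_rotStripBR_le_log` (rotated Glazman–Manolescu decay): the comparison `iSup_rotTopY_succ_le` composed with T3.
[cite: Beaton2014RotatedHoneycomb, Appendix Theorem 14 / Corollary 15 (arXiv v3 p. 19: B_T(x_c) → 0, no rate); GlazmanManolescu2019, Proposition 1.1; lane corollary with explicit constant] -/
theorem iSup_rotTopY_le_log {y : ℝ} (hy : 0 < y) (hlt : y < rotYdagger) :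
    ∃ C : ℝ, ∀ H : ℕ, 2 ≤ H →
      (⨆ Wd : ℕ, rotGFy ((rotStripV (H + 1) Wd).erase wOut) (H + 1) (IsRotTopDart (H + 1)) y) ≤
        2 * Real.cos (Real.pi / 16) / rotBcoeff y * C * Real.log H ^ (-(1 : ℝ) / 3) := by
  obtain ⟨C, hC⟩ := iSup_rotStripBR_le_log
  refine ⟨C, fun H hH => ?_⟩
  have h1 := iSup_rotTopY_succ_le (H := H) (by omega) hy hlt
  have hc : 0 ≤ 2 * Real.cos (Real.pi / 16) / rotBcoeff y :=
    div_nonneg (by linarith [rot_coeff_pos.2.2.2.2]) (rotBcoeff_pos hy hlt).le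
  calc (⨆ Wd : ℕ, rotGFy ((rotStripV (H + 1) Wd).erase wOut) (H + 1) (IsRotTopDart (H + 1)) y)
      ≤ 2 * Real.cos (Real.pi / 16) / rotBcoeff y * ⨆ Wd : ℕ, rotStripBR H Wd := h1
    _ ≤ 2 * Real.cos (Real.pi / 16) / rotBcoeff y * (C * Real.log H ^ (-(1 : ℝ) / 3)) :=
        mul_le_mul_of_nonneg_left (hC H hH) hc
    _ = 2 * Real.cos (Real.pi / 16) / rotBcoeff y * C * Real.log H ^ (-(1 : ℝ) / 3) := by ring

end Literature.Probability.RandomPlanarGeometry.SAW.HV
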